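import Mathlib
import HarnessLib
import Literature.Analysis.FluidPDE.VorticityCalculus
import Literature.Analysis.FluidPDE.HelicityDensityPseudoscalar
import Summits.NavierStokesRegularity.NavierStokesRegularity.Theorems.UnthreadedDoorAntidynamoWallEvenSectorFarPast

/-!
# Route `UnthreadedDoor` / `ThreadingFlux`, crux `PoloidalLiouville` (stmt-NavierStokesRegularity-1222), antidynamo v2 skeleton
# (sha16 `4ebf5683127b`): THE WALL ON EVERY SYMMETRIC SECTOR WHOSE CENTRE VELOCITY BREAKS THE SYMMETRY

Support file (seat leafhand-ns-unthreadeddoor-2 g0, cell decomp-ns), `--supports stmt-NavierStokesRegularity-1222 --as helper`; theorems only.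
Generalises `…WallEvenSector` / `…WallEvenSectorFarPast` (p814555 / p814783: the point reflection `σ`) to an ARBITRARY linear isometry `R`
acting about the centre `x₀`, `S y = x₀ + R (y − x₀)`.

MECHANISM (two tree facts and one line of calculus).
1. GALILEAN TWINS.  If the vorticity is `R`-symmetric as a pseudovector about `x₀`, `ω(t, x₀ + R y) = det R • R ω(t, x₀ + y)`, then the
   conjugated field `u(t, x) = R v(t, S⁻¹ x)` — again a bounded ancient mild solution of the class (Euclidean covariance,
   `CellFlux.isBoundedAncientMildSolution_frame`) — has the SAME vorticity (pseudovector law `curl_conj_rigidMotion`), so `u − v` is curl-free,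
   divergence-free and bounded, i.e. a spatial constant `k(t) = R v(t, x₀) − v(t, x₀)` (`eq_of_curl_eq_zero_of_isDivFree_of_bounded`).
   Two solutions of the vorticity formulation with the same vorticity differing by `k(t)` force `Dω(t, x)[k(t)] = 0`
   (`fderiv_curl_apply_eq_zero_of_galileanTwin`: the transport terms differ by exactly that, everything else agrees).
2. FLAT DIRECTIONS KILL UNTHREADED FLOWS.  Unthreadedness `⟪x − x₀, ω⟫ ≡ 0` differentiated along a flat direction `k` gives `⟪k, ω⟫ ≡ 0`
   (`inner_curl_eq_zero_of_fderiv_curl_apply_eq_zero`, p814555); a non-zero flat direction at every time of a far past `(−∞, t₁)` feeds the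
   cell-flux theorem Z (`CellFlux.zonalUnthreadedVorticityVanishes`, KNSS Thm 5.2 in a moving frame, PROVED) on the time-shifted field, and
   `CellFlux.forwardVanishing` propagates `curl v ≡ 0` to `[t₁, 0)` (`curl_eq_zero_of_flat_direction_farPast`).

RESULTS.
* ★ `fderiv_curl_apply_eq_zero_of_galileanTwin` — Galilean twins have translation-flat vorticity along their drift.
* ★★ `curl_eq_zero_of_flat_direction_farPast` — unthreaded + a non-zero flat direction of the vorticity at every time of a far past ⇒ irrotational.
* ★★ `curl_eq_zero_of_curl_symmetric_of_centre_not_fixed_farPast` / `constant_of_curl_symmetric_of_centre_not_fixed_farPast` — **an unthreaded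
  bounded ancient mild solution whose vorticity is `R`-pseudo-symmetric about `x₀` at all times, and whose centre velocity is NOT fixed by `R`
  in a far past (`R v(t, x₀) ≠ v(t, x₀)` for all `t < t₁`, some `t₁ ≤ 0`), is irrotational with constant slices.**  Instances: `R = σ` (even
  vorticity; residual `v(t, x₀) = 0`: p814783), `R` a rotation about an axis `a` through `x₀` (residual: `v(t, x₀) ∥ a`), `R` a reflection in a
  plane through `x₀` (residual: `v(t, x₀)` in the plane).

MEANING FOR THE WALL: every symmetric sector of `stub_scalarLiouville` collapses to its GENUINELY SYMMETRIC core — the flows that are exactly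
`R`-symmetric (`v(t, S x) = R v(t, x)`, an NS-invariant class) at a sequence of times `tₙ → −∞`; symmetric-up-to-drift flows are trivial.  The
wall on the genuinely symmetric cores (e.g. centrally symmetric unthreaded flows) stays OPEN in print beyond KNSS 2009 Thm 5.2.

HONEST LABEL: sectors of the wall; nothing here proves `stub_scalarLiouville`, `PoloidalLiouville` (1222), or bears on Navier–Stokes
regularity; no summit statement is proved (crux 1222 is INCOMPARABLE with the summit). [folklore]
[cite: KochNadirashviliSereginSverak2009, Thm 5.2 (arXiv:0709.3599 pp. 9–10)]
-/

noncomputable section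

-- the summit and its single sub-problem share the name (CONVENTIONS §1)
set_option linter.dupNamespace false

open scoped Topology InnerProductSpace RealInnerProductSpace ContDiff
open Filter Set Function Metric MeasureTheory
open Literature.Analysis.FluidPDE

namespace Summit.NavierStokesRegularity.NavierStokesRegularity.Theorems.PoloidalLiouville.Antidynamo

open Summit.NavierStokesRegularity.NavierStokesRegularity.Theorems.PoloidalLiouville
  (toroidalPotential exists_norm_curl_le constantOfIrrotational vorticityOfClass)

/-! ### ★ Galilean twins -/

/-- ★ **GALILEAN TWINS HAVE TRANSLATION-FLAT VORTICITY ALONG THEIR DRIFT.**  If `v` and `u` both solve the vorticity formulation classically on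
`(−∞,0)` and differ by a spatial constant, `u(s, y) = v(s, y) + k(s)` for all `s < 0`, then `D(curl v(t))(x)[k(t)] = 0` for all `t < 0`, `x`:
the two vorticities coincide, the stretching and diffusion terms coincide (`Du = Dv`), and the transport terms differ by `Dω[k]`. [folklore] -/
theorem fderiv_curl_apply_eq_zero_of_galileanTwin
    {v u : ℝ → EuclideanSpace ℝ (Fin 3) → EuclideanSpace ℝ (Fin 3)}
    (hV : IsVorticitySolutionOn (Iio 0) 1 v) (hU : IsVorticitySolutionOn (Iio 0) 1 u)
    (k : ℝ → EuclideanSpace ℝ (Fin 3)) (htwin : ∀ s < 0, ∀ y, u s y = v s y + k s)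
    {t : ℝ} (ht : t < 0) (x : EuclideanSpace ℝ (Fin 3)) :
    fderiv ℝ (curl (v t)) x (k t) = 0 := by
  have Ev := hV.vorticity_eq t ht x
  have Eu := hU.vorticity_eq t ht x
  -- the vorticities agree at every `s < 0`
  have hfun : ∀ s < 0, u s = fun y => v s y + k s := fun s hs => funext (htwin s hs)
  have hcurl : ∀ s < 0, ∀ y, curl (u s) y = curl (v s) y := fun s hs y => by
    rw [hfun s hs, curl_eq_curlCLM, curl_eq_curlCLM, fderiv_add_const]
  have hωfun : vorticity u t = vorticity v t := by
    funext y; rw [vorticity_apply, vorticity_apply]; exact hcurl t ht y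
  -- (a) time derivatives agree
  have ha : timeDerivWithin (Iio 0) (vorticity u) t x = timeDerivWithin (Iio 0) (vorticity v) t x := by
    rw [timeDerivWithin_apply, timeDerivWithin_apply]
    exact derivWithin_congr (fun s hs => by simp only [vorticity_apply]; exact hcurl s hs x)
      (by simp only [vorticity_apply]; exact hcurl t ht x)
  -- (b) `Du = Dv`
  have hb : fderiv ℝ (u t) x = fderiv ℝ (v t) x := by rw [hfun t ht, fderiv_add_const]
  have hconv1 : convect (u t) (vorticity u t) x = convect (v t) (vorticity v t) x + fderiv ℝ (vorticity v t) x (k t) := by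
    simp only [convect, hωfun, htwin t ht x, map_add]
  have hconv2 : convect (vorticity u t) (u t) x = convect (vorticity v t) (v t) x := by
    simp only [convect, hωfun, hb]
  rw [ha, hconv1, hconv2, hωfun] at Eu
  -- Ev : T + A = B + L ;  Eu : T + (A + D) = B + L  ⟹  D = 0
  have h2 : convect (v t) (vorticity v t) x + fderiv ℝ (vorticity v t) x (k t) = convect (v t) (vorticity v t) x :=
    add_left_cancel (Eu.trans Ev.symm)
  have h3 : fderiv ℝ (vorticity v t) x (k t) = 0 := by simpa using h2
  rw [vorticity_apply] at h3
  exact h3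

/-! ### ★★ Flat directions in a far past kill unthreaded flows -/

/-- ★★ **A NON-ZERO TRANSLATION-FLAT DIRECTION OF THE VORTICITY AT EVERY TIME OF A FAR PAST KILLS AN UNTHREADED FLOW.**  Let `v` be a bounded
ancient mild solution (`ν = 1`, duality class) with measurable slices, jointly smooth on `(−∞,0) × ℝ³` and unthreaded about `x₀`.  If for some
`t₁ ≤ 0` and every `t < t₁` there is `k ≠ 0` with `D(curl v(t))(x) k = 0` for all `x`, then `curl v ≡ 0` on `(−∞,0) × ℝ³`: `⟪k, ω(t, ·)⟫ ≡ 0`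
(p814555), Z on the time-shifted field (`timeShift_class`, p814783), forward vanishing on `[t₁, 0)`.
[cite: KochNadirashviliSereginSverak2009, Thm 5.2 (arXiv:0709.3599 pp. 9–10)] -/
theorem curl_eq_zero_of_flat_direction_farPast
    (v : ℝ → EuclideanSpace ℝ (Fin 3) → EuclideanSpace ℝ (Fin 3)) (x₀ : EuclideanSpace ℝ (Fin 3))
    (hB : Literature.Analysis.FluidPDE.IsBoundedAncientMildSolution 1 v)
    (hm : ∀ t < 0, AEStronglyMeasurable (v t) volume)
    (hsm : ContDiffOn ℝ (⊤ : ℕ∞) (Function.uncurry v) (Set.Iio 0 ×ˢ Set.univ))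
    (hun : ∀ t < 0, ∀ x, ⟪x - x₀, curl (v t) x⟫ = 0)
    (hflat : ∃ t₁ ≤ 0, ∀ t < t₁, ∃ k : EuclideanSpace ℝ (Fin 3), k ≠ 0 ∧ ∀ x, fderiv ℝ (curl (v t)) x k = 0) :
    ∀ t < 0, ∀ x, curl (v t) x = 0 := by
  obtain ⟨t₁, ht₁, hflat⟩ := hflat
  have hsm' : IsSmoothSpaceTimeOn (Iio 0) v := hsm
  -- orthogonality at every `t < t₁`
  have horth : ∀ t < t₁, ∃ k : EuclideanSpace ℝ (Fin 3), k ≠ 0 ∧ ∀ x, ⟪k, curl (v t) x⟫ = 0 := fun t ht => by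
    obtain ⟨k, hk, hD⟩ := hflat t ht
    have ht0 : t < 0 := by linarith
    have hvt : ContDiff ℝ ∞ (v t) := hsm'.contDiff_slice ht0
    exact ⟨k, hk, inner_curl_eq_zero_of_fderiv_curl_apply_eq_zero (hvt.of_le (by norm_cast)) x₀ k (hun t ht0) hD⟩
  -- Z on the shifted field
  obtain ⟨hBw, hmw, hsmw⟩ := timeShift_class hB hm hsm ht₁
  have hunw : ∀ s < 0, ∀ x, ⟪x - x₀, curl ((fun s y => v (s + t₁) y) s) x⟫ = 0 :=
    fun s hs x => hun (s + t₁) (by linarith) x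
  obtain ⟨K, hK⟩ := exists_norm_curl_le hBw hsmw
  obtain ⟨T, -, -, hlink⟩ := toroidalPotential (fun s y => v (s + t₁) y) x₀ K hsmw hK hunw
  have hw0 : ∀ s < 0, ∀ x, curl ((fun s y => v (s + t₁) y) s) x = 0 :=
    CellFlux.zonalUnthreadedVorticityVanishes (fun s y => v (s + t₁) y) x₀ T hBw hmw hsmw hlink fun s hs =>
      horth (s + t₁) (by linarith)
  have hlt : ∀ t < t₁, ∀ x, curl (v t) x = 0 := fun t ht x => by
    have h := hw0 (t - t₁) (by linarith) x
    simp only [sub_add_cancel] at h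
    exact h
  intro t ht x
  by_cases htt : t < t₁
  · exact hlt t htt x
  · have htt' : t₁ ≤ t := not_lt.mp htt
    exact CellFlux.forwardVanishing v hB hm hsm (t₁ - 1) (by linarith) (hlt (t₁ - 1) (by linarith)) t (by linarith) ht x

/-! ### ★★ Symmetric sectors whose centre velocity breaks the symmetry -/

/-- ★★ **PSEUDO-SYMMETRIC VORTICITY WITH A SYMMETRY-BREAKING CENTRE VELOCITY ⇒ IRROTATIONAL.**  Let `v` be a bounded ancient mild solution
(`ν = 1`, duality class) with measurable slices, jointly smooth on `(−∞,0) × ℝ³`, unthreaded about `x₀`, and let `R` be a linear isometry of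
`ℝ³` under which the vorticity is symmetric AS A PSEUDOVECTOR about `x₀` at every `t < 0`: `curl v(t)(x₀ + R y) = det R • R (curl v(t)(x₀ + y))`.
If in some far past the centre velocity is not fixed by `R` (`R v(t, x₀) ≠ v(t, x₀)` for all `t < t₁`, some `t₁ ≤ 0`), then `curl v ≡ 0` on
`(−∞,0) × ℝ³`.  [The conjugate `u(t, x) = R v(t, x₀ + R⁻¹(x − x₀))` is in the class with the same vorticity (`curl_conj_rigidMotion`), so it is a
Galilean twin `u = v + k(t)`, `k(t) = R v(t, x₀) − v(t, x₀)` (`eq_of_curl_eq_zero_of_isDivFree_of_bounded`); `fderiv_curl_apply_eq_zero_of_galileanTwin`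
and `curl_eq_zero_of_flat_direction_farPast` conclude.] [cite: KochNadirashviliSereginSverak2009, Thm 5.2 (arXiv:0709.3599 pp. 9–10)] -/
theorem curl_eq_zero_of_curl_symmetric_of_centre_not_fixed_farPast
    (v : ℝ → EuclideanSpace ℝ (Fin 3) → EuclideanSpace ℝ (Fin 3)) (x₀ : EuclideanSpace ℝ (Fin 3))
    (hB : Literature.Analysis.FluidPDE.IsBoundedAncientMildSolution 1 v)
    (hm : ∀ t < 0, AEStronglyMeasurable (v t) volume)
    (hsm : ContDiffOn ℝ (⊤ : ℕ∞) (Function.uncurry v) (Set.Iio 0 ×ˢ Set.univ))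
    (hun : ∀ t < 0, ∀ x, ⟪x - x₀, curl (v t) x⟫ = 0)
    (R : EuclideanSpace ℝ (Fin 3) ≃ₗᵢ[ℝ] EuclideanSpace ℝ (Fin 3))
    (hsym : ∀ t < 0, ∀ y, curl (v t) (x₀ + R y) =
      (R : EuclideanSpace ℝ (Fin 3) →L[ℝ] EuclideanSpace ℝ (Fin 3)).det • R (curl (v t) (x₀ + y)))
    (hne : ∃ t₁ ≤ 0, ∀ t < t₁, R (v t x₀) ≠ v t x₀) :
    ∀ t < 0, ∀ x, curl (v t) x = 0 := by
  have hsm' : IsSmoothSpaceTimeOn (Iio 0) v := hsm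
  obtain ⟨M, hM⟩ := hB.isBoundedOn
  -- the conjugated field `u(t, x) = R v(t, x₀ + R⁻¹ (x − x₀)) = R v(t, R⁻¹ x + c)`
  set c : EuclideanSpace ℝ (Fin 3) := x₀ - R.symm x₀ with hc
  set u : ℝ → EuclideanSpace ℝ (Fin 3) → EuclideanSpace ℝ (Fin 3) := fun s y => R (v s (R.symm y + c)) with hu
  have hBu : Literature.Analysis.FluidPDE.IsBoundedAncientMildSolution 1 u := by
    have h := CellFlux.isBoundedAncientMildSolution_frame hB R c (le_refl (0 : ℝ))
    have e : (fun s y => R (v (s + 0) (R.symm y + c))) = u := by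
      funext s y
      rw [add_zero]
    rw [e] at h
    exact h
  have hus : ∀ s < 0, ContDiff ℝ ∞ (u s) := fun s hs =>
    R.contDiff.comp ((hsm'.contDiff_slice hs).comp (R.symm.contDiff.add contDiff_const))
  have hmu : ∀ s < 0, AEStronglyMeasurable (u s) volume := fun s hs => (hus s hs).continuous.aestronglyMeasurable
  have hsmu : ContDiffOn ℝ (⊤ : ℕ∞) (Function.uncurry u) (Set.Iio 0 ×ˢ Set.univ) := by
    have hmap : ContDiff ℝ (⊤ : ℕ∞) fun p : ℝ × EuclideanSpace ℝ (Fin 3) => (p.1, R.symm p.2 + c) :=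
      contDiff_fst.prodMk ((R.symm.contDiff.comp contDiff_snd).add contDiff_const)
    have hmaps : MapsTo (fun p : ℝ × EuclideanSpace ℝ (Fin 3) => (p.1, R.symm p.2 + c)) (Iio 0 ×ˢ univ) (Iio 0 ×ˢ univ) :=
      fun p hp => ⟨hp.1, mem_univ _⟩
    exact R.contDiff.comp_contDiffOn (hsm.comp hmap.contDiffOn hmaps)
  -- the same vorticity
  have hcu : ∀ s < 0, ∀ x, curl (u s) x = curl (v s) x := by
    intro s hs x
    rw [hu, curl_conj_rigidMotion R c (v s) x]
    have e1 : R.symm x + c = x₀ + R.symm (x - x₀) := by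
      rw [hc, map_sub]
      abel
    rw [e1, ← hsym s hs (R.symm (x - x₀)), LinearIsometryEquiv.apply_symm_apply, add_sub_cancel]
  -- `u − v` is the spatial constant `k s = R v(s, x₀) − v(s, x₀)`
  have hux0 : ∀ s, u s x₀ = R (v s x₀) := by
    intro s
    simp only [hu, hc, add_sub_cancel]
  set k : ℝ → EuclideanSpace ℝ (Fin 3) := fun s => R (v s x₀) - v s x₀ with hk
  have htwin : ∀ s < 0, ∀ y, u s y = v s y + k s := by
    intro s hs y
    have hvs : ContDiff ℝ ∞ (v s) := hsm'.contDiff_slice hs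
    have hv2 : ContDiff ℝ 2 (v s) := hvs.of_le (by norm_cast)
    have hu2 : ContDiff ℝ 2 (u s) := (hus s hs).of_le (by norm_cast)
    set W : EuclideanSpace ℝ (Fin 3) → EuclideanSpace ℝ (Fin 3) := fun y => u s y - v s y with hW
    have hW2 : ContDiff ℝ 2 W := hu2.sub hv2
    have hud : ∀ y, DifferentiableAt ℝ (u s) y := fun y => (hu2.differentiable (by norm_num)) y
    have hvd : ∀ y, DifferentiableAt ℝ (v s) y := fun y => (hv2.differentiable (by norm_num)) y
    have hWcurl : ∀ y, curl W y = 0 := fun y => by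
      rw [hW, curl_sub (hud y) (hvd y), hcu s hs y, sub_self]
    have hdivv : VectorCalculus.IsDivFree (v s) :=
      (hB.isAncientMildSolution.1 s hs).isDivFree_of_contDiff (hvs.of_le (by norm_cast))
    have hdivu : VectorCalculus.IsDivFree (u s) :=
      (hBu.isAncientMildSolution.1 s hs).isDivFree_of_contDiff ((hus s hs).of_le (by norm_cast))
    have hWdiv : VectorCalculus.IsDivFree W := by
      intro y
      have h1 := hdivu y
      have h2 := hdivv y
      simp only [VectorCalculus.divergence] at h1 h2 ⊢
      rw [hW, fderiv_fun_sub (hud y) (hvd y), ContinuousLinearMap.toLinearMap_sub, map_sub, h1, h2, sub_zero]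
    obtain ⟨Mu, hMu⟩ := hBu.isBoundedOn
    have hWb : ∀ y, ‖W y‖ ≤ Mu + M := fun y => (norm_sub_le _ _).trans (add_le_add (hMu s hs y) (hM s hs y))
    have hWy : W y = W x₀ := eq_of_curl_eq_zero_of_isDivFree_of_bounded hW2 hWcurl hWdiv hWb y x₀
    have hWx0 : W x₀ = k s := by
      simp only [hW, hk]
      rw [hux0 s]
    calc u s y = W y + v s y := by rw [hW, sub_add_cancel]
      _ = v s y + k s := by rw [hWy, hWx0, add_comm]
  -- Galilean twins ⇒ flat direction `k(t)`; then the far-past Z argument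
  obtain ⟨hV, -⟩ := vorticityOfClass v hB hm hsm
  obtain ⟨hU, -⟩ := vorticityOfClass u hBu hmu hsmu
  obtain ⟨t₁, ht₁, hne⟩ := hne
  exact curl_eq_zero_of_flat_direction_farPast v x₀ hB hm hsm hun
    ⟨t₁, ht₁, fun t ht => ⟨k t, sub_ne_zero.2 (hne t ht), fun x =>
      fderiv_curl_apply_eq_zero_of_galileanTwin hV hU k htwin (by linarith) x⟩⟩

/-- ★★ **… HENCE SLICE-WISE CONSTANT** (`constantOfIrrotational`). [cite: KochNadirashviliSereginSverak2009, Thm 5.2 (arXiv:0709.3599 pp. 9–10)] -/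
theorem constant_of_curl_symmetric_of_centre_not_fixed_farPast
    (v : ℝ → EuclideanSpace ℝ (Fin 3) → EuclideanSpace ℝ (Fin 3)) (x₀ : EuclideanSpace ℝ (Fin 3))
    (hB : Literature.Analysis.FluidPDE.IsBoundedAncientMildSolution 1 v)
    (hm : ∀ t < 0, AEStronglyMeasurable (v t) volume)
    (hsm : ContDiffOn ℝ (⊤ : ℕ∞) (Function.uncurry v) (Set.Iio 0 ×ˢ Set.univ))
    (hun : ∀ t < 0, ∀ x, ⟪x - x₀, curl (v t) x⟫ = 0)
    (R : EuclideanSpace ℝ (Fin 3) ≃ₗᵢ[ℝ] EuclideanSpace ℝ (Fin 3))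
    (hsym : ∀ t < 0, ∀ y, curl (v t) (x₀ + R y) =
      (R : EuclideanSpace ℝ (Fin 3) →L[ℝ] EuclideanSpace ℝ (Fin 3)).det • R (curl (v t) (x₀ + y)))
    (hne : ∃ t₁ ≤ 0, ∀ t < t₁, R (v t x₀) ≠ v t x₀) :
    ∀ t < 0, ∃ b : EuclideanSpace ℝ (Fin 3), ∀ x, v t x = b :=
  constantOfIrrotational v hB hsm (curl_eq_zero_of_curl_symmetric_of_centre_not_fixed_farPast v x₀ hB hm hsm hun R hsym hne)

/-- ★★ **THE WALL'S LETTER, SYMMETRIC SECTORS.**  If the vorticity of the wall's flow is represented by a toroidal potential,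
`curl (v t) x = ∇T(t, x) × (x − x₀)` (so the flow is unthreaded about `x₀`), is `R`-pseudo-symmetric about `x₀` at every `t < 0`, and the
centre velocity is not fixed by `R` in a far past, then `∇T × (x − x₀) ≡ 0` — the conclusion of `StubScalarLiouville` on this sector, without
(E1), the bound or the smoothness of `T`. [cite: KochNadirashviliSereginSverak2009, Thm 5.2 (arXiv:0709.3599 pp. 9–10)] -/
theorem stubScalarLiouville_of_curl_symmetric_of_centre_not_fixed_farPast
    (v : ℝ → EuclideanSpace ℝ (Fin 3) → EuclideanSpace ℝ (Fin 3)) (x₀ : EuclideanSpace ℝ (Fin 3))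
    (T : ℝ → EuclideanSpace ℝ (Fin 3) → ℝ)
    (hB : Literature.Analysis.FluidPDE.IsBoundedAncientMildSolution 1 v)
    (hm : ∀ t < 0, AEStronglyMeasurable (v t) volume)
    (hsm : ContDiffOn ℝ (⊤ : ℕ∞) (Function.uncurry v) (Set.Iio 0 ×ˢ Set.univ))
    (hrep : ∀ t < 0, ∀ x, Literature.Analysis.FluidPDE.curl (v t) x =
      Literature.Analysis.FluidPDE.cross (gradient (T t) x) (x - x₀))
    (R : EuclideanSpace ℝ (Fin 3) ≃ₗᵢ[ℝ] EuclideanSpace ℝ (Fin 3))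
    (hsym : ∀ t < 0, ∀ y, curl (v t) (x₀ + R y) =
      (R : EuclideanSpace ℝ (Fin 3) →L[ℝ] EuclideanSpace ℝ (Fin 3)).det • R (curl (v t) (x₀ + y)))
    (hne : ∃ t₁ ≤ 0, ∀ t < t₁, R (v t x₀) ≠ v t x₀) :
    ∀ t < 0, ∀ x, Literature.Analysis.FluidPDE.cross (gradient (T t) x) (x - x₀) = 0 := by
  -- a toroidal field is tangent to the spheres: `⟪y, a × y⟫ = 0`
  have hun : ∀ t < 0, ∀ x, ⟪x - x₀, curl (v t) x⟫ = 0 := fun t ht x => by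
    rw [hrep t ht x]
    simp [cross, crossProduct, PiLp.inner_apply, Fin.sum_univ_three]
    ring
  intro t ht x
  rw [← hrep t ht x]
  exact curl_eq_zero_of_curl_symmetric_of_centre_not_fixed_farPast v x₀ hB hm hsm hun R hsym hne t ht x

end Summit.NavierStokesRegularity.NavierStokesRegularity.Theorems.PoloidalLiouville.Antidynamo

end
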